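import Literature.Probability.RandomPlanarGeometry.HexSAWSurfaceWallRenewalLandingLaw
import HarnessLib

/-!
# Slack four, four down steps: the first excursion is not a bump

For the self-avoiding walk on the honeycomb lattice (brick-wall frame) in the half-plane `Y ≤ 0`, consider an IRREDUCIBLE
POSITIVE WALL BRIDGE `ω ∈ ipwb m` at SLACK FOUR (`m = 6k + 4`, `k = visits m ω ≥ 2`) with FOUR down steps, in the vertical
profile of `profile_of_card_stepsD_eq_four` (`…FourDownProfile`): down times `p₁ < p₂ < p₃ < p₄`, up times
`r₁ < r₂ < r₃ < r₄`, `pᵢ < rᵢ`, the initial wall run `(i, 0)`, `i ≤ p₁`, the first dive at the odd time `p₁`.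

* `leading_bump_four_down_slack_four_false` — the first up step does NOT come before the second down step: `r₁ < p₂` is
  impossible.  So the vertical order of such a walk never starts `D U`; this removes the five Dyck orders `DUDDDUUU`,
  `DUDDUDUU`, `DUDUDDUU`, `DUDDUUDU`, `DUDUDUDU` from the fourteen at once (the lane's census: of the fourteen orders of
  four down and four up steps exactly `DDDDUUUU`, `DDDUDUUU`, `DDDUUDUU`, `DDUDDUUU`, `DDUUDDUU` occur at slack four).

PROOF (the landing law).  If `r₁ < p₂` the first excursion is a BUMP: the dive at `(p₁, 0)`, a horizontal plateau on the
row `−1` (`run_const_velocity` of `…SecondGap`), the rise at `r₁` back to the wall, then a wall run up to the dive at `p₂`.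
By `two_mem_nearRenewal_four_down` (`…LandingLaw`) the time `2` is a visit time, so `p₁ ≥ 3`.  A plateau to the LEFT ends
under the initial wall run and the walk, back on the wall at `(b, 0)` with `1 ≤ b ≤ p₁ − 1`, is boxed between two sites
of the initial run (or dives at once onto its own plateau); so the plateau goes right, `ω (r₁ + 1) = (r₁ − 1, 0)`.  The
wall run after it cannot go left (it would dive onto the plateau, or run into the initial wall run), so it goes right and
dives at the column `p₂ − 2 ≥ p₁ + 2`.  LANDING LAW (`landing_law_four_down`): a left step landing on the even column
`p₁ + 1` would put an interior visit at the column `p₁ + 1`, the located gap of the first dive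
(`wallTimes_apply_ne_of_dive` of `…SecondGap`) — so no left step lands on `p₁ + 1`, and by the intermediate value
property (`exists_descent`) the whole walk after the time `p₂` stays in the columns `≥ p₁ + 2`.  But then every column
after the time `p₁ − 1` is `≥ p₁`, every column up to it is `≤ p₁ − 1`, and the even time `p₁ − 1 ≥ 2` is a wall-renewal
time (`isWRen_of_profile`), against irreducibility.

STATUS: lane theorem of the a-idea-1 bridge/renewal lineage (car 94-B «no leading bump»), second module of the ORDER
EXCLUSION for four down steps at slack four (after `…LandingLaw`; FINDING-HEX-WALL-SLACK-FOUR-LAW, the four-down law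
`12·N = (k − 2)(2k⁴ − 7k³ + 4k² + 7k + 6)`).  OURS (new in writing, routine): checked against the lane's enumeration of all
irreducible positive wall bridges at slack four for `k ≤ 8` (no vertical order starting `D U` among the `2463` four-down
walks at `k = 8`, nor at any smaller `k`).  The printed sources carry the renewal / irreducible-bridge structure
(Madras–Slade §4.2, Definition 4.2.1, remark before (4.2.21), p. 94) and the brickwork frame of the honeycomb lattice
(Enting–Jensen §7.4.2, Fig. 7.10) — none states this fact.  No `set_option maxHeartbeats` line is used.
-/

namespace Literature.Probability.RandomPlanarGeometry.SAW.HexBW.Wall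

open Finset Filter Function
open Literature.Probability.LatticeModels Literature.Probability.Percolation SimpleGraph

variable {ω : ℕ → Site 2}

/-- [folklore] Two coordinates determine a site of `ℤ²`. -/
private theorem site_ext_lb {p q : Site 2} (h0 : p 0 = q 0) (h1 : p 1 = q 1) : p = q := by
  funext k
  fin_cases k
  · exact h0
  · exact h1

open Classical in
/-- **No leading bump.** For an irreducible positive wall bridge of length `6k + 4` (`k ≥ 2`) with `k` visits and four down
steps, in the vertical profile of `profile_of_card_stepsD_eq_four` (down times `p₁ < p₂ < p₃ < p₄`, up times
`r₁ < r₂ < r₃ < r₄`, `p₁ < r₁`, `p₂ < r₂`, initial wall run up to the first dive at the odd time `p₁`, all other steps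
horizontal), the first up step does not precede the second down step: `r₁ < p₂` is impossible (the orders `D U …` do not
occur at slack four).  NEW, a-idea-1 lineage.
[cite: MadrasSlade1993, §4.2, Definition 4.2.1 (p. 90), remark before (4.2.21) (p. 94); EntingJensen2009, §7.4.2, Fig. 7.10] -/
theorem leading_bump_four_down_slack_four_false {k m : ℕ} (hk : 2 ≤ k) (hm : m = 6 * k + 4) (hω : ω ∈ ipwb m)
    (hv : visits m ω = k) (hcD : #(stepsD m ω) = 4) {p₁ p₂ p₃ p₄ r₁ r₂ r₃ r₄ : ℕ}
    (hD : stepsD m ω = {p₁, p₂, p₃, p₄}) (hU : stepsU m ω = {r₁, r₂, r₃, r₄}) (h12 : p₁ < p₂) (h23 : p₂ < p₃)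
    (h34 : p₃ < p₄) (hr12 : r₁ < r₂) (hr23 : r₂ < r₃) (hr34 : r₃ < r₄) (h1 : p₁ < r₁) (h2 : p₂ < r₂) (hp1 : 1 ≤ p₁)
    (hpodd : p₁ % 2 = 1) (hR0 : ∀ i, i ≤ p₁ → ω i 0 = i ∧ ω i 1 = 0) (hP1x : ω (p₁ + 1) 0 = p₁)
    (hP1y : ω (p₁ + 1) 1 = -1)
    (hhor : ∀ i, i < m → i ∉ stepsD m ω → i ∉ stepsU m ω →
      ω (i + 1) 1 = ω i 1 ∧ (ω (i + 1) 0 = ω i 0 + 1 ∨ ω (i + 1) 0 = ω i 0 - 1))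
    (ho : r₁ < p₂) : False := by
  classical
  obtain ⟨hpw, hn1, hirr⟩ := mem_ipwb.1 hω
  obtain ⟨hw, hb⟩ := mem_pwb.1 hpw
  obtain ⟨ha, -⟩ := mem_wbr.1 hw
  obtain ⟨hh, -, -⟩ := mem_archs.1 ha
  obtain ⟨hs, hhp⟩ := mem_hpw.1 hh
  obtain ⟨h0, -, hbw, hinj⟩ := mem_saws_iff.1 hs
  have hX0 : ω 0 0 = 0 := by rw [h0]; rfl
  have hb' : ∀ i, 1 ≤ i → i ≤ m → 0 < ω i 0 ∧ ω i 0 ≤ ω m 0 := fun i hi1 hi2 => by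
    have := hb i hi1 hi2; rwa [hX0] at this
  have hmem : ∀ i, i ≤ m → i ∈ {i | i ≤ m} := fun i hi => hi
  have hmD : ∀ i, i ∈ stepsD m ω ↔ i = p₁ ∨ i = p₂ ∨ i = p₃ ∨ i = p₄ := fun i => by
    rw [hD]; simp only [Finset.mem_insert, Finset.mem_singleton]
  have hmU : ∀ i, i ∈ stepsU m ω ↔ i = r₁ ∨ i = r₂ ∨ i = r₃ ∨ i = r₄ := fun i => by
    rw [hU]; simp only [Finset.mem_insert, Finset.mem_singleton]
  obtain ⟨hrn1, hrx1, hry1, hrpar1⟩ := of_mem_stepsU_coord hbw (i := r₁) (by rw [hU]; simp)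
  obtain ⟨hrn2, -, hry2, -⟩ := of_mem_stepsU_coord hbw (i := r₂) (by rw [hU]; simp)
  obtain ⟨hpn2, hpx2, hpy2, hppar2⟩ := of_mem_stepsD_coord hbw (i := p₂) (by rw [hD]; simp)
  -- the time `2` is a visit time, so the first dive is at `p₁ ≥ 3`
  obtain ⟨-, -, -, h2y⟩ := two_mem_nearRenewal_four_down hk hm hω hv hcD
  have hp3 : 3 ≤ p₁ := by
    by_contra hlt
    have hp : p₁ = 1 := by omega
    rw [hp] at hP1y
    norm_num at hP1y
    omega
  -- run 1: the plateau of the bump on the row `−1`, times `p₁ + 1 … r₁`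
  obtain ⟨e₁, he₁, hrun1⟩ := run_const_velocity hinj (show p₁ + 1 ≤ r₁ by omega) hrn1.le
    (fun i hi1 hi2 => hhor i (by omega) (by rw [hmD]; omega) (by rw [hmU]; omega))
  simp only [hP1x, hP1y] at hrun1
  have hR1 := hrun1 r₁ (by omega) le_rfl
  -- the wall site after the rise
  have hry1' : ω (r₁ + 1) 1 = 0 := by rw [hry1, hR1.2]; norm_num
  -- the plateau has length `≥ 1`
  have hl1 : p₁ + 2 ≤ r₁ := by
    by_contra hlt
    have he : r₁ = p₁ + 1 := by omega
    have hc := hinj (hmem (r₁ + 1) (by omega)) (hmem p₁ (by omega))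
      (site_ext_lb (by rw [hrx1, hR1.1, (hR0 p₁ le_rfl).1, he]; simp) (by rw [hry1', (hR0 p₁ le_rfl).2]))
    omega
  -- the second up step is not the step right after the first one (the walk stays in `Y ≤ 0`)
  have hr2ne : r₂ ≠ r₁ + 1 := by
    intro he
    have := hhp (r₂ + 1) (by omega)
    rw [hry2, he, hry1'] at this
    norm_num at this
  -- the plateau goes RIGHT
  have he1 : e₁ = 1 := by
    rcases he₁ with h | h
    · exact h
    exfalso
    rw [h] at hrun1 hR1
    have hpos := (hb' r₁ (by omega) hrn1.le).1
    rw [hR1.1] at hpos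
    -- back on the wall at `(b, 0)`, `b = 2p₁ + 1 − r₁ ∈ [1, p₁ − 1]`
    have hbx : ω (r₁ + 1) 0 = ((2 * p₁ + 1 - r₁ : ℕ) : ℤ) := by
      rw [hrx1, hR1.1]; push_cast [show r₁ ≤ 2 * p₁ + 1 by omega]; push_cast [show p₁ + 1 ≤ r₁ by omega]; ring
    rcases Nat.lt_or_ge (r₁ + 1) p₂ with hlt | hge
    · -- a horizontal step on the wall from `(b, 0)`: both neighbours belong to the initial wall run
      obtain ⟨hy, hx | hx⟩ := hhor (r₁ + 1) (by omega) (by rw [hmD]; omega) (by rw [hmU]; omega)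
      · have hc := hinj (hmem (r₁ + 1 + 1) (by omega)) (hmem (2 * p₁ + 2 - r₁) (by omega))
          (site_ext_lb (by rw [hx, hbx, (hR0 _ (by omega)).1]; push_cast [show r₁ ≤ 2 * p₁ + 1 by omega,
              show r₁ ≤ 2 * p₁ + 2 by omega]; ring)
            (by rw [hy, hry1', (hR0 _ (by omega)).2]))
        omega
      · have hc := hinj (hmem (r₁ + 1 + 1) (by omega)) (hmem (2 * p₁ - r₁) (by omega))
          (site_ext_lb (by rw [hx, hbx, (hR0 _ (by omega)).1]; push_cast [show r₁ ≤ 2 * p₁ + 1 by omega,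
              show r₁ ≤ 2 * p₁ by omega]; ring)
            (by rw [hy, hry1', (hR0 _ (by omega)).2]))
        omega
    · -- the dive at `p₂ = r₁ + 1` lands on the plateau site `ω r₁`
      have he : p₂ = r₁ + 1 := by omega
      have hc := hinj (hmem (p₂ + 1) (by omega)) (hmem r₁ (by omega))
        (site_ext_lb (by rw [hpx2, he, hrx1]) (by rw [hpy2, he, hry1', hR1.2]; norm_num))
      omega
  rw [he1] at hrun1 hR1
  simp only [one_mul] at hrun1 hR1
  have hbx : ω (r₁ + 1) 0 = (r₁ : ℤ) - 1 := by rw [hrx1, hR1.1]; push_cast [show p₁ + 1 ≤ r₁ by omega]; ring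
  -- run 2: the wall run after the bump, times `r₁ + 1 … p₂`
  obtain ⟨e₂, he₂, hrun2⟩ := run_const_velocity hinj (show r₁ + 1 ≤ p₂ by omega) hpn2.le
    (fun i hi1 hi2 => hhor i (by omega) (by rw [hmD]; omega) (by rw [hmU]; omega))
  simp only [hbx, hry1'] at hrun2
  have hP2 := hrun2 p₂ (by omega) le_rfl
  -- the wall run goes RIGHT
  have he2 : e₂ = 1 := by
    rcases he₂ with h | h
    · exact h
    exfalso
    rw [h] at hrun2 hP2
    -- the dive at `p₂` is onto `(a₂, −1)`, `a₂ = 2r₁ − p₂`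
    have hpos := (hb' p₂ (by omega) hpn2.le).1
    rw [hP2.1] at hpos
    rcases Nat.lt_or_ge (2 * r₁) (p₁ + p₂) with hlt | hge
    · -- `a₂ ≤ p₁ − 1`: the wall site `(a₂, 0) = ω p₂` belongs to the initial wall run
      have hc := hinj (hmem p₂ hpn2.le) (hmem (2 * r₁ - p₂) (by omega))
        (site_ext_lb (by rw [hP2.1, (hR0 _ (by omega)).1]; push_cast [show r₁ + 1 ≤ p₂ by omega,
            show p₂ ≤ 2 * r₁ by omega]; ring)
          (by rw [hP2.2, (hR0 _ (by omega)).2]))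
      omega
    · -- `a₂ ≥ p₁`: the site `(a₂, −1) = ω (p₂ + 1)` is the plateau site at the time `2r₁ + 1 − p₂`
      have hj := hrun1 (2 * r₁ + 1 - p₂) (by omega) (by omega)
      have hc := hinj (hmem (p₂ + 1) (by omega)) (hmem (2 * r₁ + 1 - p₂) (by omega))
        (site_ext_lb (by rw [hpx2, hP2.1, hj.1]; push_cast [show r₁ + 1 ≤ p₂ by omega, show p₂ ≤ 2 * r₁ + 1 by omega,
            show p₁ + 1 ≤ 2 * r₁ + 1 - p₂ by omega]; ring)
          (by rw [hpy2, hP2.2, hj.2]; norm_num))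
      omega
  rw [he2] at hrun2 hP2
  simp only [one_mul] at hrun2 hP2
  have hax : ω p₂ 0 = (p₂ : ℤ) - 2 := by rw [hP2.1]; push_cast [show r₁ + 1 ≤ p₂ by omega]; ring
  -- the dive column `p₂ − 2` is odd and `> r₁ − 1 ≥ p₁ + 1`, so `≥ p₁ + 2`
  have hp2odd : p₂ % 2 = 1 := by
    have := hppar2; rw [hpx2, hpy2, hax, hP2.2] at this; omega
  have ha2 : (p₁ : ℤ) + 2 ≤ ω p₂ 0 := by rw [hax]; omega
  -- LANDING LAW: no left step lands on the located gap `p₁ + 1`, so the walk stays in the columns `≥ p₁ + 2` after `p₂`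
  obtain ⟨hland, -, -⟩ := landing_law_four_down hk hm hω hv hcD
  have hgap := wallTimes_apply_ne_of_dive hpw (i := p₁) (by omega) (hR0 p₁ le_rfl).2
    (by rw [(hR0 (p₁ - 1) (by omega)).1, (hR0 p₁ le_rfl).1]; push_cast [hp1]; ring) hP1y
  rw [(hR0 p₁ le_rfl).1] at hgap
  have hbar : ∀ j, p₂ ≤ j → j ≤ m → (p₁ : ℤ) + 2 ≤ ω j 0 := by
    by_contra hne
    push Not at hne
    obtain ⟨j, hj1, hj2, hj3⟩ := hne
    have hpj : p₂ < j := lt_of_le_of_ne hj1 (by rintro rfl; exact absurd ha2 (not_le.2 hj3))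
    obtain ⟨i, hi1, hi2, hxi, hxi'⟩ := exists_descent hbw hpj hj2 (c := (p₁ : ℤ) + 1) (by omega) (by omega)
    obtain ⟨t, ht, hxt⟩ := hland i (by omega) (by rw [hxi, hxi']; ring) (by rw [hxi']; omega)
    exact hgap t (Finset.mem_erase.1 ht).2 (by rw [hxt, hxi'])
  -- the even time `p₁ − 1 ≥ 2` is a wall-renewal time
  refine hirr (p₁ - 1) (by omega) (by omega) (isWRen_of_profile hb (by omega) (by omega) (hR0 (p₁ - 1) (by omega)).2
    (fun i hi1 hi2 => by rw [(hR0 i (by omega)).1, (hR0 (p₁ - 1) (by omega)).1]; exact_mod_cast hi2)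
    (fun j hj1 hj2 => ?_))
  rw [(hR0 (p₁ - 1) (by omega)).1]
  rcases Nat.lt_or_ge j (p₁ + 1) with hj | hj
  · rw [(hR0 j (by omega)).1]; exact_mod_cast hj1
  rcases Nat.lt_or_ge j (r₁ + 1) with hj' | hj'
  · rw [(hrun1 j hj (by omega)).1]; push_cast [show p₁ + 1 ≤ j by omega]; omega
  rcases Nat.lt_or_ge j (p₂ + 1) with hj'' | hj''
  · rw [(hrun2 j hj' (by omega)).1]; push_cast [show r₁ + 1 ≤ j by omega]; omega
  · have := hbar j (by omega) hj2
    push_cast [show 1 ≤ p₁ by omega]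
    omega

end Literature.Probability.RandomPlanarGeometry.SAW.HexBW.Wall
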